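/-
COR-CM (cell pub-hodgecm2) — RSCONJ («`RecordSystem.conj`», IDENT-LEMMA component (e) «SPACE by construction»; coordinator 04:22Z,
PLANNER-A RSCONJ TABLE HOME∕INBOX l.14934), row F2a (part 3 of the chain l.15702): the conjugation homeomorphism of Shimura SETS.
Pen prover-pub-hodgecm2-rsconj-p1-g0-0 (desk bytes `ident-e/rsconj-p1/ShimuraSetConj.v2.lean` 8e4ce53b9a87d021, row part verbatim;
independent twin mukey-p10 f644346027f069cf; checker ident-2 GRADE #3).  KERNEL: definitions by explicit formula + theorems; no instance,
no named fact, no notation, no `sorry`.  HC_CM is NOT proved; HELD — WORLD = C FINAL; this file discharges no END binder and claims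
nothing about (iv-c).
-/
import Summits.HodgeConjecture.CorCM.B01.Transposition.HComp.RecordSystemConjFrame
import HarnessLib

/-!
# RSCONJ row F2a: the conjugation homeomorphism `Sh_K(U(H), 𝔹²)(ℂ) ≃ₜ Sh_{K'}(U(cH), 𝔹²)(ℂ)`, `[x, aK] ↦ [x̄, (c ⊗ 1) a · K']`

For a CM field `L` with complex conjugation `c`, `H ∈ M₃(L)`, an embedding `τ : L →+* ℂ` with frame `T` (`Tᴴ H^τ T = diag(1,1,-1)`),
and levels `K ≤ U(H)(𝔸_{L⁺,f})`, `K' ≤ U(cH)(𝔸_{L⁺,f})` with `a ∈ K ↔ (c ⊗ 1) a ∈ K'`: the tree's Shimura sets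
`UnitaryGroup.ShimuraSet L H τ T hT K = U(H)(L⁺) \ [𝔹² × U(H)(𝔸_{L⁺,f})/K]` and `ShimuraSet L (cH) τ T̄ hT̄ K'` (conjugate Gram matrix
`conjGram L H = c(H)`, conjugate frame `conjFrame T = T̄`, SAME `τ` — the frame file `RecordSystemConjFrame`) are homeomorphic by
`[x, aK] ↦ [x̄, (c ⊗ 1)(a) K']` ([Milne2005ShimuraVarieties] Lemma 5.13 for the double-coset presentation; §12 for conjugates of Shimura
data).  Ingredients, all proved here over the tree's carriers:

* §1 `orbitQuotientHomeomorphOfEquivariant` — an equivariant homeomorphism along a group isomorphism descends to orbit spaces (general);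
* §2 `conjU21` (entrywise conjugation on `U(2,1)`, `J` real) and `conjU21_smul_conjBall : ḡ • x̄ = (g • x)‾` on the ball;
* §3 `ratToU21_rationalConj : T̄⁻¹ (cγ)^τ T̄ = conj (T⁻¹ γ^τ T)` and the equivariance `conjBall_ratToU21_smul`;
* §4 `cosetFactorConj`, `pairConj`, `pairConj_smul`, **`shimuraSetConj`** with `shimuraSetConj_mk` ∕ `shimuraSetConj_symm_mk` (`rfl`);
* §5 the level hypothesis at transported levels: `mem_iff_groupConj_mem_transport`, `mem_transport_symm_iff_groupConj_mem`
  (the levels `c⁻¹K'` of `smallLevelConjBack`).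

Consumed by the conjugate complex record system (`RecordSystemConjComplex`, its `pts`) and thereby by `RecordSystem.exists_conj`.

References: [Milne2005ShimuraVarieties] Lemma 5.13 p. 57, §12; [PlatonovRapinchuk1994] §5.1 (through wb-10's `UnitaryGroupFinAdelicConj`).
-/

set_option autoImplicit false

noncomputable section

open CategoryTheory AlgebraicGeometry NumberField IsDedekindDomain Matrix
open Literature.AlgebraicGeometry.Motives
open Literature.NumberTheory.Automorphic.Liu2021.AppendixC (C5.OpenCompactSubgroup C5.SmallLevel)

namespace Summit.HodgeConjecture.CorCM.Model.RecordSystemConj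

section RowF2a

open Function MulAction Topology
open scoped Matrix ComplexConjugate
open Literature.AlgebraicGeometry.ShimuraVarieties
open Literature.NumberTheory.Automorphic Literature.NumberTheory.Automorphic.UnitaryGroup
open Literature.NumberTheory.Automorphic.ShimuraDissection
open Literature.Geometry.ComplexHyperbolic Literature.Geometry.ComplexHyperbolic.BallModel
open Summit.HodgeConjecture.CorCM.D2Bridge.UnitaryGroupConj

/-! ## §1. Orbit spaces along an equivariant homeomorphism over a group isomorphism (general) -/

section OrbitTransport

variable {Γ Γ' X X' : Type*} [Group Γ] [Group Γ'] [MulAction Γ X] [MulAction Γ' X']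
  [TopologicalSpace X] [TopologicalSpace X']

/-- **Transport of orbit spaces**: a homeomorphism `f : X ≃ₜ X'` which is equivariant along a group ISOMORPHISM `φ : Γ ≃* Γ'`
(`f (γ • x) = φ γ • f x`) descends to a homeomorphism of the orbit spaces `Γ \ X ≃ₜ Γ' \ X'` (quotient topologies; the map on
representatives is `f`, its inverse `f⁻¹`, which is equivariant along `φ⁻¹`). [folklore] -/
def orbitQuotientHomeomorphOfEquivariant (φ : Γ ≃* Γ') (f : X ≃ₜ X') (hf : ∀ (γ : Γ) (x : X), f (γ • x) = φ γ • f x) :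
    orbitRel.Quotient Γ X ≃ₜ orbitRel.Quotient Γ' X' where
  toFun := Quotient.map' f fun a b (hab : a ∈ orbit Γ b) => by
    obtain ⟨γ, rfl⟩ := mem_orbit_iff.mp hab
    exact mem_orbit_iff.mpr ⟨φ γ, (hf γ b).symm⟩
  invFun := Quotient.map' f.symm fun a b (hab : a ∈ orbit Γ' b) => by
    obtain ⟨γ', rfl⟩ := mem_orbit_iff.mp hab
    refine mem_orbit_iff.mpr ⟨φ.symm γ', ?_⟩
    apply f.injective
    rw [hf, MulEquiv.apply_symm_apply, Homeomorph.apply_symm_apply, Homeomorph.apply_symm_apply]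
  left_inv c := by
    induction c using Quotient.inductionOn' with | h x => ?_
    exact congrArg (Quotient.mk'' : X → orbitRel.Quotient Γ X) (f.symm_apply_apply x)
  right_inv c := by
    induction c using Quotient.inductionOn' with | h x => ?_
    exact congrArg (Quotient.mk'' : X' → orbitRel.Quotient Γ' X') (f.apply_symm_apply x)
  continuous_toFun := f.continuous.quotient_map' _
  continuous_invFun := f.symm.continuous.quotient_map' _

/-- The transported class of `x` is the class of `f x`. [folklore] -/
@[simp] theorem orbitQuotientHomeomorphOfEquivariant_mk (φ : Γ ≃* Γ') (f : X ≃ₜ X')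
    (hf : ∀ (γ : Γ) (x : X), f (γ • x) = φ γ • f x) (x : X) :
    orbitQuotientHomeomorphOfEquivariant φ f hf (Quotient.mk'' x) = Quotient.mk'' (f x) := rfl

/-- The inverse transport sends the class of `x'` to the class of `f⁻¹ x'`. [folklore] -/
@[simp] theorem orbitQuotientHomeomorphOfEquivariant_symm_mk (φ : Γ ≃* Γ') (f : X ≃ₜ X')
    (hf : ∀ (γ : Γ) (x : X), f (γ • x) = φ γ • f x) (x' : X') :
    (orbitQuotientHomeomorphOfEquivariant φ f hf).symm (Quotient.mk'' x') = Quotient.mk'' (f.symm x') := rfl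

end OrbitTransport

/-! ## §2. Complex conjugation on `U(2,1)` and on the ball -/

section BallConj

/-- `J = diag(1,1,-1)` has real entries: `conj J = J`. [folklore] -/
theorem J_map_conj : BallModel.J.map (starRingEnd ℂ) = BallModel.J := by
  ext i j
  fin_cases i <;> fin_cases j <;> simp [BallModel.J]

/-- Entrywise complex conjugation preserves the relation `gᴴ J g = J`. [folklore] -/
theorem conjFrame_mem_U21 (g : U21) : conjFrame (g : GL3) ∈ U21 := by
  change (((conjFrame (g : GL3) : GL (Fin 3) ℂ) : Matrix (Fin 3) (Fin 3) ℂ))ᴴ * BallModel.J *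
      ((conjFrame (g : GL3) : GL (Fin 3) ℂ) : Matrix (Fin 3) (Fin 3) ℂ) = BallModel.J
  have key := congrArg (fun M : Matrix (Fin 3) (Fin 3) ℂ => M.map (starRingEnd ℂ)) (mat_mem g)
  simp only [Matrix.map_mul, J_map_conj] at key
  rw [coe_conjFrame, ← Matrix.conjTranspose_map (starRingEnd ℂ) (fun x => by simp)]
  exact key

/-- **Complex conjugation `g ↦ ḡ` on `U(2,1)`** (entrywise; `J` is real), as a group endomorphism. [folklore] -/
def conjU21 : U21 →* U21 where
  toFun g := ⟨conjFrame (g : GL3), conjFrame_mem_U21 g⟩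
  map_one' := Subtype.ext (map_one (Matrix.GeneralLinearGroup.map (n := Fin 3) (starRingEnd ℂ)))
  map_mul' _ _ := Subtype.ext (map_mul (Matrix.GeneralLinearGroup.map (n := Fin 3) (starRingEnd ℂ)) _ _)

/-- Underlying element of `GL₃(ℂ)`: `conjU21 g = conjFrame g`. [folklore] -/
@[simp] theorem coe_conjU21 (g : U21) : ((conjU21 g : U21) : GL3) = conjFrame (g : GL3) := rfl

/-- `ḡ̄ = g` on `U(2,1)`. [folklore] -/
@[simp] theorem conjU21_conjU21 (g : U21) : conjU21 (conjU21 g) = g := by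
  refine Subtype.ext (Units.ext (Matrix.ext fun i j => ?_))
  simp only [coe_conjU21, coe_conjFrame, Matrix.map_apply, starRingEnd_self_apply]

/-- `ḡ · lift x̄ = conj (g · lift x)` (the vector `W3`). [folklore] -/
theorem W3_conjU21_conjBall (g : U21) (x : Ball) : W3 (conjU21 g) (conjBall x) = star (W3 g x) := by
  unfold W3
  rw [lift_conjBall]
  exact conjFrame_mulVec_star (g : GL3) (BallModel.lift x)

/-- **The action of `U(2,1)` on the ball commutes with conjugation**: `ḡ • x̄ = (g • x)‾` (the fractional-linear formula has
conjugated coefficients). [folklore] -/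
theorem conjU21_smul_conjBall (g : U21) (x : Ball) : conjU21 g • conjBall x = conjBall (g • x) := by
  apply Ball.ext
  intro i
  rw [smul_val, W3_conjU21_conjBall]
  change star (W3 g x) (Fin.castSucc i) / star (W3 g x) 2 = (starRingEnd ℂ) ((g • x).1 i)
  rw [smul_val, map_div₀]
  rfl

/-- `conjBall` is continuous. [folklore] -/
theorem continuous_conjBall : Continuous conjBall :=
  Continuous.subtype_mk (continuous_star.comp continuous_subtype_val) _

/-- **Complex conjugation of the ball as a homeomorphism** (an involution). [folklore] -/
def conjBallHomeomorph : Ball ≃ₜ Ball where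
  toFun := conjBall
  invFun := conjBall
  left_inv := conjBall_conjBall
  right_inv := conjBall_conjBall
  continuous_toFun := continuous_conjBall
  continuous_invFun := continuous_conjBall

/-- `conjBallHomeomorph x = x̄`. [folklore] -/
@[simp] theorem conjBallHomeomorph_apply (x : Ball) : conjBallHomeomorph x = conjBall x := rfl

/-- `conjBallHomeomorph⁻¹ x = x̄`. [folklore] -/
@[simp] theorem conjBallHomeomorph_symm_apply (x : Ball) : conjBallHomeomorph.symm x = conjBall x := rfl

end BallConj

/-! ## §3. CM conjugation on `U(H)(L⁺)` and the archimedean projection -/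

section Rational

variable (L : Type) [Field L] [NumberField L] [IsCMField L] (H : Matrix (Fin 3) (Fin 3) L)

variable (τ : L →+* ℂ) (T : GL (Fin 3) ℂ) (hT : formCongr (starRingEnd ℂ) T (H.map τ) = BallModel.J)

/-- `GL₃(τ) (c γ) = conj (GL₃(τ) γ)` (CM: `τ ∘ c = conj ∘ τ`). [folklore] -/
theorem glMap_tau_glMap_complexConj (γ : GL (Fin 3) L) :
    Matrix.GeneralLinearGroup.map τ
        (Matrix.GeneralLinearGroup.map ((IsCMField.complexConj L : L ≃ₐ[↥(maximalRealSubfield L)] L) : L →+* L) γ) =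
      conjFrame (Matrix.GeneralLinearGroup.map τ γ) := by
  refine Units.ext (Matrix.ext fun i j => ?_)
  simp only [conjFrame, Matrix.GeneralLinearGroup.map_apply, RingHom.coe_coe, IsCMField.complexEmbedding_complexConj]

/-- **`T̄⁻¹ (cγ)^τ T̄ = conj (T⁻¹ γ^τ T)`**: the archimedean projection of `U(cH)(L⁺)` through the conjugate frame is the complex
conjugate of that of `U(H)(L⁺)` through `T`. [folklore] -/
theorem ratToU21_rationalConj (γ : rational (↥(maximalRealSubfield L)) L (IsCMField.complexConj L) 3 H) :
    ratToU21 L (conjGram L H) τ (conjFrame T) (formCongr_conjFrame L H τ T hT) (rationalConj L H γ) =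
      conjU21 (ratToU21 L H τ T hT γ) := by
  apply Subtype.ext
  change ((archProjU21EmbCM L (conjGram L H) τ (conjFrame T) (formCongr_conjFrame L H τ T hT)
      (rationalToArch (↥(maximalRealSubfield L)) L (IsCMField.complexConj L) 3 (conjGram L H) (rationalConj L H γ)) : U21) :
        GL (Fin 3) ℂ) =
    conjFrame ((archProjU21EmbCM L H τ T hT
      (rationalToArch (↥(maximalRealSubfield L)) L (IsCMField.complexConj L) 3 H γ) : U21) : GL (Fin 3) ℂ)
  rw [coe_archProjU21EmbCM_rationalToArch, coe_archProjU21EmbCM_rationalToArch, coe_rationalConj, glMap_tau_glMap_complexConj,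
    conjFrame, conjFrame, conjFrame, map_mul, map_mul, map_inv]

/-- **Equivariance of `x ↦ x̄` along `γ ↦ c γ`** for the actions of `U(H)(L⁺)`, `U(cH)(L⁺)` on the ball through the frames `T`,
`T̄`: `(γ • x)‾ = (c γ) • x̄`. [folklore] -/
theorem conjBall_ratToU21_smul (γ : rational (↥(maximalRealSubfield L)) L (IsCMField.complexConj L) 3 H) (x : Ball) :
    conjBall (ratToU21 L H τ T hT γ • x) =
      ratToU21 L (conjGram L H) τ (conjFrame T) (formCongr_conjFrame L H τ T hT) (rationalConj L H γ) • conjBall x := by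
  rw [ratToU21_rationalConj, conjU21_smul_conjBall]

end Rational

/-! ## §4. The conjugation homeomorphism of Shimura sets -/

section ShimuraSetConj

variable (L : Type) [Field L] [NumberField L] [IsCMField L] (H : Matrix (Fin 3) (Fin 3) L)
  (τ : L →+* ℂ) (T : GL (Fin 3) ℂ) (hT : formCongr (starRingEnd ℂ) T (H.map τ) = BallModel.J)
  (K : Subgroup ↥(finAdelic (↥(maximalRealSubfield L)) L (IsCMField.complexConj L) 3 H))
  (K' : Subgroup ↥(finAdelic (↥(maximalRealSubfield L)) L (IsCMField.complexConj L) 3 (conjGram L H)))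
  (hKK' : ∀ a : ↥(finAdelic (↥(maximalRealSubfield L)) L (IsCMField.complexConj L) 3 H), a ∈ K ↔ groupConj L H a ∈ K')

/-- The ball factor: `x ↦ x̄` between the `U(H)(L⁺)`-ball (through `T`) and the `U(cH)(L⁺)`-ball (through `T̄`). [folklore] -/
def ballFactorConj :
    Through (ratToU21 L H τ T hT) Ball ≃ₜ
      Through (ratToU21 L (conjGram L H) τ (conjFrame T) (formCongr_conjFrame L H τ T hT)) Ball :=
  ((Through.mkHomeomorph (ratToU21 L H τ T hT) Ball).symm.trans conjBallHomeomorph).trans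
    (Through.mkHomeomorph (ratToU21 L (conjGram L H) τ (conjFrame T) (formCongr_conjFrame L H τ T hT)) Ball)

/-- `ballFactorConj (mk x) = mk x̄`. [folklore] -/
@[simp] theorem ballFactorConj_mk (x : Ball) :
    ballFactorConj L H τ T hT (Through.mk (ratToU21 L H τ T hT) Ball x) =
      Through.mk (ratToU21 L (conjGram L H) τ (conjFrame T) (formCongr_conjFrame L H τ T hT)) Ball (conjBall x) := rfl

/-- `ballFactorConj⁻¹ (mk x) = mk x̄`. [folklore] -/
@[simp] theorem ballFactorConj_symm_mk (x : Ball) :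
    (ballFactorConj L H τ T hT).symm
        (Through.mk (ratToU21 L (conjGram L H) τ (conjFrame T) (formCongr_conjFrame L H τ T hT)) Ball x) =
      Through.mk (ratToU21 L H τ T hT) Ball (conjBall x) := rfl

include hKK' in
/-- `(c ⊗ 1)` respects the coset relations of `K` and `K'`. [folklore] -/
private theorem leftRel_groupConj (a b : ↥(finAdelic (↥(maximalRealSubfield L)) L (IsCMField.complexConj L) 3 H))
    (hab : QuotientGroup.leftRel K a b) : QuotientGroup.leftRel K' (groupConj L H a) (groupConj L H b) := by
  rw [QuotientGroup.leftRel_apply] at hab ⊢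
  rw [← map_inv, ← map_mul]
  exact (hKK' _).1 hab

include hKK' in
/-- `(c ⊗ 1)⁻¹` respects the coset relations of `K'` and `K`. [folklore] -/
private theorem leftRel_groupConj_symm
    (a b : ↥(finAdelic (↥(maximalRealSubfield L)) L (IsCMField.complexConj L) 3 (conjGram L H)))
    (hab : QuotientGroup.leftRel K' a b) :
    QuotientGroup.leftRel K ((groupConj L H).symm a) ((groupConj L H).symm b) := by
  rw [QuotientGroup.leftRel_apply] at hab ⊢
  refine (hKK' _).2 ?_
  rwa [map_mul, map_inv, ContinuousMulEquiv.apply_symm_apply, ContinuousMulEquiv.apply_symm_apply]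

/-- The finite-adelic factor: `aK ↦ (c ⊗ 1)(a) · K'` between the coset spaces `U(H)(𝔸_{L⁺,f})/K` and `U(cH)(𝔸_{L⁺,f})/K'`
(`K' = (c ⊗ 1) K`), a homeomorphism of the quotient topologies. [folklore] -/
def cosetFactorConj :
    CosetSpace (rationalToFinAdelic (↥(maximalRealSubfield L)) L (IsCMField.complexConj L) 3 H) K ≃ₜ
      CosetSpace (rationalToFinAdelic (↥(maximalRealSubfield L)) L (IsCMField.complexConj L) 3 (conjGram L H)) K' where
  toFun := Quotient.map' (groupConj L H) (leftRel_groupConj L H K K' hKK')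
  invFun := Quotient.map' (groupConj L H).symm (leftRel_groupConj_symm L H K K' hKK')
  left_inv y := by
    induction y using Quotient.inductionOn' with | h a => ?_
    exact congrArg (Quotient.mk'' : _ → ↥(finAdelic (↥(maximalRealSubfield L)) L (IsCMField.complexConj L) 3 H) ⧸ K)
      ((groupConj L H).symm_apply_apply a)
  right_inv y := by
    induction y using Quotient.inductionOn' with | h a => ?_
    exact congrArg
      (Quotient.mk'' : _ → ↥(finAdelic (↥(maximalRealSubfield L)) L (IsCMField.complexConj L) 3 (conjGram L H)) ⧸ K')
      ((groupConj L H).apply_symm_apply a)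
  continuous_toFun := (groupConj L H).continuous.quotient_map' _
  continuous_invFun := (groupConj L H).symm.continuous.quotient_map' _

/-- `cosetFactorConj (aK) = (c ⊗ 1)(a) K'`. [folklore] -/
@[simp] theorem cosetFactorConj_pt (a : ↥(finAdelic (↥(maximalRealSubfield L)) L (IsCMField.complexConj L) 3 H)) :
    cosetFactorConj L H K K' hKK' (CosetSpace.pt _ K a) = CosetSpace.pt _ K' (groupConj L H a) := rfl

/-- `cosetFactorConj⁻¹ (aK') = (c ⊗ 1)⁻¹(a) K`. [folklore] -/
@[simp] theorem cosetFactorConj_symm_pt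
    (a : ↥(finAdelic (↥(maximalRealSubfield L)) L (IsCMField.complexConj L) 3 (conjGram L H))) :
    (cosetFactorConj L H K K' hKK').symm (CosetSpace.pt _ K' a) = CosetSpace.pt _ K ((groupConj L H).symm a) := rfl

/-- The product map `(x, aK) ↦ (x̄, (c ⊗ 1)(a) K')` on `𝔹² × U(H)(𝔸_{L⁺,f})/K`. [folklore] -/
def pairConj :
    Through (ratToU21 L H τ T hT) Ball ×
        CosetSpace (rationalToFinAdelic (↥(maximalRealSubfield L)) L (IsCMField.complexConj L) 3 H) K ≃ₜ
      Through (ratToU21 L (conjGram L H) τ (conjFrame T) (formCongr_conjFrame L H τ T hT)) Ball ×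
        CosetSpace (rationalToFinAdelic (↥(maximalRealSubfield L)) L (IsCMField.complexConj L) 3 (conjGram L H)) K' :=
  (ballFactorConj L H τ T hT).prodCongr (cosetFactorConj L H K K' hKK')

/-- **Equivariance of `(x, aK) ↦ (x̄, (c ⊗ 1)(a) K')` along `γ ↦ c γ`.** [folklore] -/
theorem pairConj_smul (γ : rational (↥(maximalRealSubfield L)) L (IsCMField.complexConj L) 3 H)
    (p : Through (ratToU21 L H τ T hT) Ball ×
      CosetSpace (rationalToFinAdelic (↥(maximalRealSubfield L)) L (IsCMField.complexConj L) 3 H) K) :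
    pairConj L H τ T hT K K' hKK' (γ • p) = rationalConj L H γ • pairConj L H τ T hT K K' hKK' p := by
  obtain ⟨z, y⟩ := p
  obtain ⟨a, rfl⟩ := CosetSpace.pt_surjective _ K y
  rw [Prod.smul_mk, Prod.smul_mk, CosetSpace.smul_pt]
  refine Prod.ext ?_ ?_
  · change Through.mk _ Ball (conjBall (ratToU21 L H τ T hT γ • (Through.mk (ratToU21 L H τ T hT) Ball).symm z)) =
      rationalConj L H γ • Through.mk _ Ball (conjBall ((Through.mk (ratToU21 L H τ T hT) Ball).symm z))
    rw [Through.smul_mk, conjBall_ratToU21_smul]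
  · change cosetFactorConj L H K K' hKK' (CosetSpace.pt _ K (rationalToFinAdelic _ L _ 3 H γ * a)) =
      rationalConj L H γ • cosetFactorConj L H K K' hKK' (CosetSpace.pt _ K a)
    rw [cosetFactorConj_pt, cosetFactorConj_pt, CosetSpace.smul_pt, map_mul, groupConj_rationalToFinAdelic]

/-- **The conjugation homeomorphism of Shimura sets** `Sh_K(U(H), 𝔹²)(ℂ) ≃ₜ Sh_{K'}(U(cH), 𝔹²)(ℂ)` for `K' = (c ⊗ 1) K`, along the
SAME embedding `τ` with the conjugate frame `T̄`: `[x, aK] ↦ [x̄, (c ⊗ 1)(a) K']` — the complex conjugation of `Sh_K(ℂ)` read on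
the conjugate hermitian space `V^{(c)}` (Gram matrix `c(H)`), whose tautological ball at `τ` is the conjugate ball
([Milne2005ShimuraVarieties] §12, conjugates of Shimura varieties; [Liu2021] Prop. C.5 at `τ' = τ` vs `τ̄`).  Well defined and
bijective because `γ ↦ c γ : U(H)(L⁺) ≃ U(cH)(L⁺)` intertwines both actions (`conjBall_ratToU21_smul`,
`groupConj_rationalToFinAdelic`). [cite: Milne2005ShimuraVarieties, Lemma 5.13 p. 57 and §12] -/
def shimuraSetConj :
    ShimuraSet L H τ T hT K ≃ₜ ShimuraSet L (conjGram L H) τ (conjFrame T) (formCongr_conjFrame L H τ T hT) K' :=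
  orbitQuotientHomeomorphOfEquivariant (rationalConj L H) (pairConj L H τ T hT K K' hKK') (pairConj_smul L H τ T hT K K' hKK')

/-- **`shimuraSetConj [x, aK] = [x̄, (c ⊗ 1)(a) K']`.** [cite: Milne2005ShimuraVarieties, Lemma 5.13 p. 57] -/
@[simp] theorem shimuraSetConj_mk (x : Ball) (a : ↥(finAdelic (↥(maximalRealSubfield L)) L (IsCMField.complexConj L) 3 H)) :
    shimuraSetConj L H τ T hT K K' hKK' (ShimuraSet.mk L H τ T hT K x a) =
      ShimuraSet.mk L (conjGram L H) τ (conjFrame T) (formCongr_conjFrame L H τ T hT) K' (conjBall x) (groupConj L H a) := rfl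

/-- **`shimuraSetConj⁻¹ [x, aK'] = [x̄, (c ⊗ 1)⁻¹(a) K]`.** [cite: Milne2005ShimuraVarieties, Lemma 5.13 p. 57] -/
@[simp] theorem shimuraSetConj_symm_mk (x : Ball)
    (a : ↥(finAdelic (↥(maximalRealSubfield L)) L (IsCMField.complexConj L) 3 (conjGram L H))) :
    (shimuraSetConj L H τ T hT K K' hKK').symm
        (ShimuraSet.mk L (conjGram L H) τ (conjFrame T) (formCongr_conjFrame L H τ T hT) K' x a) =
      ShimuraSet.mk L H τ T hT K (conjBall x) ((groupConj L H).symm a) := rfl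

end ShimuraSetConj

/-! ## §5. The level hypothesis for transported levels -/

section Levels

variable (L : Type) [Field L] [NumberField L] [IsCMField L] (H : Matrix (Fin 3) (Fin 3) L)

/-- For a level `K ≤ U(H)(𝔸_{L⁺,f})` and its transport `(c ⊗ 1) K` (tree `C5.OpenCompactSubgroup.transport`):
`a ∈ K ↔ (c ⊗ 1) a ∈ (c ⊗ 1) K`. [folklore] -/
theorem mem_iff_groupConj_mem_transport
    (K : C5.OpenCompactSubgroup ↥(finAdelic (↥(maximalRealSubfield L)) L (IsCMField.complexConj L) 3 H))
    (a : ↥(finAdelic (↥(maximalRealSubfield L)) L (IsCMField.complexConj L) 3 H)) :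
    a ∈ K.1 ↔ groupConj L H a ∈ (C5.OpenCompactSubgroup.transport (groupConj L H) K).1 := by
  change a ∈ K.1 ↔ groupConj L H a ∈ K.1.map (groupConj L H).toMulEquiv.toMonoidHom
  rw [Subgroup.mem_map_equiv]
  exact (iff_of_eq (congrArg (· ∈ K.1) ((groupConj L H).symm_apply_apply a))).symm

/-- For a level `K' ≤ U(cH)(𝔸_{L⁺,f})` and its back-transport `(c ⊗ 1)⁻¹ K'`: `a ∈ (c ⊗ 1)⁻¹ K' ↔ (c ⊗ 1) a ∈ K'` — the
hypothesis of `shimuraSetConj` at the levels `K = c⁻¹K'` of the re-indexed system `K' ↦ M_{c⁻¹K'} ⊗_{L,c} L`. [folklore] -/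
theorem mem_transport_symm_iff_groupConj_mem
    (K' : C5.OpenCompactSubgroup ↥(finAdelic (↥(maximalRealSubfield L)) L (IsCMField.complexConj L) 3 (conjGram L H)))
    (a : ↥(finAdelic (↥(maximalRealSubfield L)) L (IsCMField.complexConj L) 3 H)) :
    a ∈ (C5.OpenCompactSubgroup.transport (groupConj L H).symm K').1 ↔ groupConj L H a ∈ K'.1 := by
  change a ∈ K'.1.map (groupConj L H).symm.toMulEquiv.toMonoidHom ↔ groupConj L H a ∈ K'.1
  rw [Subgroup.mem_map_equiv]
  exact iff_of_eq (congrArg (· ∈ K'.1) ((groupConj L H).symm_symm ▸ rfl))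

end Levels

end RowF2a

end Summit.HodgeConjecture.CorCM.Model.RecordSystemConj

end
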